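import Summits.AtomisticToContinuum.HydrodynamicLimit.Theorems.RelayRaceLocalityConeLocalisationBubbleAssemblyB
import Literature.Analysis.FluidPDE.IsentropicEulerUniformLifespan
import HarnessLib

/-!
# RelayRaceLocality · ConeLocalisation — bubble stub, helper (AP): the a-priori estimate and the assembly

Third file of helper (AP) for the lead-held stub `stub_bubble : BubbleAtScale` of line `Sketch` (zoomed-bubble-transplant)
of the crux item `stmt-AtomisticToContinuum-12504` (`ConeLocalisation`), lead prover-line-stmt-AtomisticToContinuum-12504-0
(2026-08-17): the bootstrap a-priori estimate `apriori_bounds` (continuity principle on the `C⁰`/`C¹` envelopes of part B;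
improvement by drift (input (T)), by `ap_deriv_improve`, and support by input (D)), and the registered stub
`bubbleAtScale_of : ZoomHyp → ReadoutHyp → EnergyHyp → SupportHyp → ExistenceHyp → BubbleAtScale` (constant solution for
`κ = 0`; for `κ > 0` the a-priori estimate is the hypothesis of the existence input (E), and applied to its solution gives
the conclusions). All constants are functions of `M` and of the constants of the inputs, chosen before `σ`.
-/

noncomputable section

namespace Summit.AtomisticToContinuum.HydrodynamicLimit.Theorems.ConeLocalisation.Bubble

open Set MeasureTheory
open Literature.MathematicalPhysics.KineticTheory Literature.Analysis.FluidPDE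
  Literature.Analysis.FunctionSpaces
open Summit.AtomisticToContinuum.HydrodynamicLimit.Theorems.ConeLocalisation

/-! ## The a-priori estimate -/

/-- **The a-priori estimate of the bubble lemma.** For a classical solution on `[0, T₀)` at reduced diameter `σ` whose
data are a bubble of slope `κ > 0` at scale `r` round the guarded constant state `(ρ̄, θ̄, ū)` (equal to it off
`B(x₀, 2r)`, `ScaleDeviation` bounds), with `48 M κ r ≤ 1`, `20 B κ r ≤ 1`, `c_D T₀ ≤ r/4`, `2 C_T B T₀ ≤ r`, `T₀ ≤ 10 r`
(`B ≥ √(K_S C_H 81270900) + 9`), the deviation stays `≤ 6κr` in `C⁰` and `≤ Bκ` in `C¹` on all of `[0, T₀)`, and the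
solution equals the constant state off `B(x₀, 4r)`. PROOF: continuity principle (`ap_bootstrap_two`) on the two envelopes
`ap_env0_spec`, `ap_env1_spec`; improvement of the `C⁰` envelope by the drift bound (input (T) at level `4M`, slope `2Bκ`, time
`< T₀`), of the `C¹` envelope by `ap_deriv_improve` on `[0, t)` and continuity from the left; support by `ap_support`. -/
theorem apriori_bounds {ηD ηT ηH ηZ KS CH CT cD M σ ρbar θbar P r κ T₀ B : ℝ} {ubar : V3} {x₀ : T3}
    {ρ θ : ℝ → T3 → ℝ} {u : ℝ → T3 → V3}
    (hDm : ∀ σ : ℝ, 0 < σ → ∀ (T : ℝ) (ρ θ : ℝ → T3 → ℝ) (u : ℝ → T3 → V3),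
        IsHardSphereEulerSolution σ T ρ u θ →
      ∀ (ρbar θbar : ℝ) (ubar : V3), 0 < ρbar → 0 < θbar → ρbar * σ ^ 3 < ηD → θbar ≤ M + 1 →
        ‖ubar‖ ≤ M + 1 →
      ∀ t : ℝ, 0 ≤ t → t < T →
        (∀ s ∈ Set.Icc 0 t, ∀ x, ρ s x * σ ^ 3 < ηD ∧ θ s x ≤ M + 1 ∧ ‖u s x‖ ≤ M + 1) →
      ∀ (x₀ : T3) (a : ℝ),
        (∀ x, a ≤ Torus.euclidDist x x₀ → ρ 0 x = ρbar ∧ u 0 x = ubar ∧ θ 0 x = θbar) →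
      ∀ x, a + cD * t < Torus.euclidDist x x₀ → ρ t x = ρbar ∧ u t x = ubar ∧ θ t x = θbar)
    (hTm : ∀ σ : ℝ, 0 < σ → ∀ (T : ℝ) (ρ θ : ℝ → T3 → ℝ) (u : ℝ → T3 → V3),
      IsHardSphereEulerSolution σ T ρ u θ → ∀ t ∈ Ico 0 T, ∀ A : ℝ, 0 ≤ A →
      (∀ s ∈ Icc 0 t, ∀ x, (4 * M)⁻¹ ≤ ρ s x ∧ ρ s x ≤ 4 * M ∧ (4 * M)⁻¹ ≤ θ s x ∧ θ s x ≤ 4 * M ∧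
        ‖u s x‖ ≤ 4 * M ∧ ρ s x * σ ^ 3 ≤ ηT ∧ ∀ i : Fin 3, |Torus.partialDeriv i (ρ s) x| ≤ A ∧
        ‖Torus.partialDeriv i (u s) x‖ ≤ A ∧ |Torus.partialDeriv i (θ s) x| ≤ A) →
      ∀ x, |ρ t x - ρ 0 x| ≤ CT * A * t ∧ ‖u t x - u 0 x‖ ≤ CT * A * t ∧ |θ t x - θ 0 x| ≤ CT * A * t)
    (hS₁ : ∀ f : T3 → ℝ, Torus.IsSmooth f → ∀ (x : T3) (l : Fin 3),
      Torus.partialDeriv l f x ^ 2 ≤ KS * fieldD3 f)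
    (hS₂ : ∀ w : T3 → V3, Torus.IsSmooth w → ∀ (x : T3) (l : Fin 3),
      ‖Torus.partialDeriv l w x‖ ^ 2 ≤ KS * fieldD3V w)
    (hHm : ∀ σ : ℝ, 0 < σ → ∀ (ρbar θbar : ℝ) (ubar : V3), M⁻¹ ≤ ρbar → ρbar ≤ M → M⁻¹ ≤ θbar → θbar ≤ M →
      ‖ubar‖ ≤ M → ρbar * σ ^ 3 ≤ ηH →
      ∀ T : ℝ, 0 < T → T ≤ 1 → ∀ (ρ θ : ℝ → T3 → ℝ) (u : ℝ → T3 → V3), IsHardSphereEulerSolution σ T ρ u θ →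
      (∀ t ∈ Ico 0 T, ∀ x, |ρ t x - ρbar| ≤ 1 / (4 * M) ∧ |θ t x - θbar| ≤ 1 / (4 * M) ∧
        ‖u t x - ubar‖ ≤ 1 / (4 * M) ∧ ∀ i : Fin 3, |Torus.partialDeriv i (ρ t) x| ≤ 1 ∧
        ‖Torus.partialDeriv i (u t) x‖ ≤ 1 ∧ |Torus.partialDeriv i (θ t) x| ≤ 1) →
      ∀ t ∈ Ico 0 T, D3 ρ u θ t ≤ CH * D3 ρ u θ 0)
    (hZm : ∀ (x₀ : T3) (m a : ℝ), 1 < m → 0 < a → m * a < 1 / 4 →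
      ∃ Zpt : T3 → T3,
      (∀ y, Torus.euclidDist (Zpt y) x₀ = m⁻¹ * Torus.euclidDist y x₀) ∧
      (∀ x, Torus.euclidDist x x₀ < 1 / (2 * m) → ∃ y, Zpt y = x) ∧
      (∀ (f : T3 → ℝ) (b : ℝ), Torus.IsSmooth f → (∀ x, a ≤ Torus.euclidDist x x₀ → f x = b) →
        Torus.IsSmooth (fun y => f (Zpt y)) ∧
        (∀ y (i : Fin 3), Torus.partialDeriv i (fun y => f (Zpt y)) y = m⁻¹ * Torus.partialDeriv i f (Zpt y)) ∧
        (∀ y, m * a ≤ Torus.euclidDist y x₀ → f (Zpt y) = b)) ∧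
      (∀ (w : T3 → V3) (b : V3), Torus.IsSmooth w → (∀ x, a ≤ Torus.euclidDist x x₀ → w x = b) →
        Torus.IsSmooth (fun y => w (Zpt y)) ∧
        (∀ y (i : Fin 3), Torus.partialDeriv i (fun y => w (Zpt y)) y = m⁻¹ • Torus.partialDeriv i w (Zpt y)) ∧
        (∀ y, m * a ≤ Torus.euclidDist y x₀ → w (Zpt y) = b)) ∧
      (∀ (σ T : ℝ) (ρ θ : ℝ → T3 → ℝ) (u : ℝ → T3 → V3), IsHardSphereEulerSolution σ T ρ u θ →
        ∀ (ρbar θbar : ℝ) (ubar : V3),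
        (∀ t ∈ Ico 0 T, ∀ x, a ≤ Torus.euclidDist x x₀ → ρ t x = ρbar ∧ θ t x = θbar ∧ u t x = ubar) →
        (∀ t ∈ Ico 0 T, ∀ x, ρ t x * σ ^ 3 ≤ ηZ) →
        IsHardSphereEulerSolution σ (m * T) (fun s y => ρ (s / m) (Zpt y)) (fun s y => u (s / m) (Zpt y))
          (fun s y => θ (s / m) (Zpt y))))
    (hcD : 0 < cD) (hCT : 0 < CT) (hKS : 0 ≤ KS) (hCH : 0 ≤ CH) (hM : 1 ≤ M) (hσ : 0 < σ)
    (h1 : M⁻¹ ≤ ρbar) (h2 : ρbar ≤ M) (h3 : M⁻¹ ≤ θbar) (h4 : θbar ≤ M) (h5 : ‖ubar‖ ≤ M)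
    (hP : (ρbar + 1 / (4 * M)) * σ ^ 3 ≤ P) (hPD : P < ηD) (hPT : P ≤ ηT) (hPZ : P ≤ ηZ)
    (hHη : ρbar * σ ^ 3 ≤ ηH) (hr : 0 < r) (hr16 : r ≤ 1 / 16) (hκ : 0 < κ)
    (hB : Real.sqrt (KS * CH * 81270900) + 9 ≤ B) (hε₁ : 48 * M * (κ * r) ≤ 1) (hε₂ : 20 * B * (κ * r) ≤ 1)
    (hT₁ : cD * T₀ ≤ r / 4) (hT₂ : 2 * CT * B * T₀ ≤ r) (hT₃ : T₀ ≤ 10 * r)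
    (hsol : IsHardSphereEulerSolution σ T₀ ρ u θ)
    (hsupp : ∀ x, 2 * r ≤ Torus.euclidDist x x₀ → ρ 0 x = ρbar ∧ θ 0 x = θbar ∧ u 0 x = ubar)
    (hSρ : ScaleDeviation (ρ 0) ρbar r κ) (hSθ : ScaleDeviation (θ 0) θbar r κ)
    (hSu : ScaleDeviationV (u 0) ubar r κ) :
    ∀ t ∈ Ico 0 T₀, ∀ x, |ρ t x - ρbar| ≤ 6 * κ * r ∧ |θ t x - θbar| ≤ 6 * κ * r ∧
      ‖u t x - ubar‖ ≤ 6 * κ * r ∧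
      (∀ i : Fin 3, |Torus.partialDeriv i (ρ t) x| ≤ B * κ ∧ ‖Torus.partialDeriv i (u t) x‖ ≤ B * κ ∧
        |Torus.partialDeriv i (θ t) x| ≤ B * κ) ∧
      (4 * r ≤ Torus.euclidDist x x₀ → ρ t x = ρbar ∧ θ t x = θbar ∧ u t x = ubar) := by
  -- positivity bookkeeping
  have hM0 : 0 < M := by linarith
  have hκr : 0 < κ * r := mul_pos hκ hr
  have hC₂0 : 0 ≤ Real.sqrt (KS * CH * 81270900) := Real.sqrt_nonneg _
  have hB9 : 9 ≤ B := by linarith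
  have hB0 : 0 < B := by linarith
  have h10r : 0 < 10 * r := by positivity
  have hδ : 12 * (κ * r) ≤ 1 / (4 * M) := by
    rw [le_div_iff₀ (by positivity)]
    nlinarith
  have hA : 10 * r * (2 * B * κ) ≤ 1 := by nlinarith
  -- zoom parameters and the zoom map
  obtain ⟨m, hm⟩ : ∃ m : ℝ, m = (10 * r)⁻¹ := ⟨_, rfl⟩
  obtain ⟨a, ha⟩ : ∃ a : ℝ, a = 9 / 4 * r := ⟨_, rfl⟩
  have hm1 : 1 < m := by
    rw [hm, one_lt_inv₀ h10r]
    linarith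
  have ha0 : 0 < a := by rw [ha]; positivity
  have hma : m * a < 1 / 4 := by
    rw [hm, ha, inv_mul_eq_div, div_lt_iff₀ h10r]
    linarith
  obtain ⟨Z, -, hZsurj, hZs, hZv, hZsol⟩ := hZm x₀ m a hm1 ha0 hma
  -- the two envelopes
  obtain ⟨E₀, E0c, E0d, E0m⟩ := ap_env0_spec hsol ρbar θbar ubar
  obtain ⟨E₁, E1c, E1d, E1m⟩ := ap_env1_spec hsol
  have init0 : E₀ 0 ≤ 6 * κ * r := by
    have := E0m 0 (κ * r) hκr.le fun x => ⟨(hSρ x).1, (hSθ x).1, (hSu x).1⟩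
    linarith
  have init1 : E₁ 0 ≤ B * κ := by
    have := E1m 0 κ hκ.le fun x i => ⟨((hSρ x).2 i i i).1, ((hSu x).2 i i i).1, ((hSθ x).2 i i i).1⟩
    nlinarith
  -- weak bounds of the envelopes ⇒ pointwise weak bounds
  have hweak : ∀ t ∈ Ico 0 T₀, (∀ s ∈ Icc 0 t, E₀ s ≤ 2 * (6 * κ * r) ∧
      E₁ s ≤ 2 * (B * κ)) →
      ∀ s ∈ Icc 0 t, ∀ x, |ρ s x - ρbar| ≤ 12 * (κ * r) ∧ |θ s x - θbar| ≤ 12 * (κ * r) ∧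
        ‖u s x - ubar‖ ≤ 12 * (κ * r) ∧
        ∀ i : Fin 3, |Torus.partialDeriv i (ρ s) x| ≤ 2 * B * κ ∧ ‖Torus.partialDeriv i (u s) x‖ ≤ 2 * B * κ ∧
          |Torus.partialDeriv i (θ s) x| ≤ 2 * B * κ := by
    intro t ht hwk s hs x
    have hs' : s ∈ Ico 0 T₀ := ⟨hs.1, hs.2.trans_lt ht.2⟩
    obtain ⟨w0, w1⟩ := hwk s hs
    obtain ⟨d1, d2, d3⟩ := E0d s hs' x
    refine ⟨by linarith, by linarith, by linarith, fun i => ?_⟩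
    obtain ⟨f1, f2, f3⟩ := E1d s hs' x i
    exact ⟨by linarith, by linarith, by linarith⟩
  -- the improvement step
  have himp : ∀ t ∈ Ico 0 T₀, (∀ s ∈ Icc 0 t, E₀ s ≤ 2 * (6 * κ * r) ∧
      E₁ s ≤ 2 * (B * κ)) → E₀ t ≤ 6 * κ * r ∧ E₁ t ≤ B * κ := by
    intro t ht hwk
    have hw := hweak t ht hwk
    have hw0 : ∀ s ∈ Icc 0 t, ∀ x, |ρ s x - ρbar| ≤ 12 * (κ * r) ∧ |θ s x - θbar| ≤ 12 * (κ * r) ∧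
        ‖u s x - ubar‖ ≤ 12 * (κ * r) := fun s hs x => ⟨(hw s hs x).1, (hw s hs x).2.1, (hw s hs x).2.2.1⟩
    -- support on `[0, t]`
    have hfar : ∀ s ∈ Icc 0 t, ∀ x, 2 * r + cD * s < Torus.euclidDist x x₀ →
        ρ s x = ρbar ∧ θ s x = θbar ∧ u s x = ubar := fun s hs =>
      ap_support hDm hM hσ h1 h2 h3 h4 h5 hP hPD hsol hsupp ⟨hs.1, hs.2.trans_lt ht.2⟩ hδ
        fun s' hs' x => hw0 s' ⟨hs'.1, hs'.2.trans hs.2⟩ x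
    -- `C⁰` improvement by the drift bound
    have hstate : ∀ s ∈ Icc 0 t, ∀ x, (4 * M)⁻¹ ≤ ρ s x ∧ ρ s x ≤ 4 * M ∧ (4 * M)⁻¹ ≤ θ s x ∧ θ s x ≤ 4 * M ∧
        ‖u s x‖ ≤ 4 * M ∧ ρ s x * σ ^ 3 ≤ ηT ∧ ∀ i : Fin 3, |Torus.partialDeriv i (ρ s) x| ≤ 2 * B * κ ∧
        ‖Torus.partialDeriv i (u s) x‖ ≤ 2 * B * κ ∧ |Torus.partialDeriv i (θ s) x| ≤ 2 * B * κ := by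
      intro s hs x
      obtain ⟨a1, a2, a3, a4⟩ := hw s hs x
      obtain ⟨b1, b2, b3, b4, b5, -, -, b8, -, -⟩ := ap_state hM h1 h2 h3 h4 h5 hδ a1 a2 a3
      exact ⟨b1, b2, b3, b4, b5, ((mul_le_mul_of_nonneg_right b8 (pow_pos hσ 3).le).trans hP).trans hPT, a4⟩
    have hdrift := hTm σ hσ T₀ ρ θ u hsol t ht (2 * B * κ) (by positivity) hstate
    have hCt : CT * (2 * B * κ) * t ≤ κ * r := by
      have h' : CT * (2 * B * κ) * t ≤ CT * (2 * B * κ) * T₀ :=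
        mul_le_mul_of_nonneg_left ht.2.le (by positivity)
      have h'' : CT * (2 * B * κ) * T₀ = κ * (2 * CT * B * T₀) := by ring
      rw [h''] at h'
      exact h'.trans (mul_le_mul_of_nonneg_left hT₂ hκ.le)
    have hc0 : E₀ t ≤ 6 * κ * r := by
      have hpt : ∀ x, |ρ t x - ρbar| ≤ 2 * (κ * r) ∧ |θ t x - θbar| ≤ 2 * (κ * r) ∧
          ‖u t x - ubar‖ ≤ 2 * (κ * r) := by
        intro x
        obtain ⟨q1, q2, q3⟩ := hdrift x
        have i1 := (hSρ x).1
        have i2 := (hSθ x).1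
        have i3 := (hSu x).1
        refine ⟨?_, ?_, ?_⟩
        · calc |ρ t x - ρbar| = |(ρ t x - ρ 0 x) + (ρ 0 x - ρbar)| := by rw [sub_add_sub_cancel]
            _ ≤ |ρ t x - ρ 0 x| + |ρ 0 x - ρbar| := abs_add_le _ _
            _ ≤ 2 * (κ * r) := by linarith
        · calc |θ t x - θbar| = |(θ t x - θ 0 x) + (θ 0 x - θbar)| := by rw [sub_add_sub_cancel]
            _ ≤ |θ t x - θ 0 x| + |θ 0 x - θbar| := abs_add_le _ _
            _ ≤ 2 * (κ * r) := by linarith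
        · calc ‖u t x - ubar‖ = ‖(u t x - u 0 x) + (u 0 x - ubar)‖ := by rw [sub_add_sub_cancel]
            _ ≤ ‖u t x - u 0 x‖ + ‖u 0 x - ubar‖ := norm_add_le _ _
            _ ≤ 2 * (κ * r) := by linarith
      have := E0m t (2 * (κ * r)) (by positivity) hpt
      linarith
    -- `C¹` improvement by zoom + energy + read-out on `[0, t)` and continuity from the left
    have hc1 : E₁ t ≤ B * κ := by
      rcases eq_or_lt_of_le ht.1 with ht0 | ht0
      · rw [← ht0]
        exact init1
      · have hcDt : cD * t < r / 4 := (mul_lt_mul_of_pos_left ht.2 hcD).trans_le hT₁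
        have ht10 : t ≤ 10 * r := ht.2.le.trans hT₃
        have hder := ap_deriv_improve hS₁ hS₂ hHm hZsurj hZs hZv hZsol hKS hCH hM hσ h1 h2 h3 h4 h5 hP hPZ hHη
          hr hκ.le hm ha hδ hA hcDt hcD.le ht10 hsol ht ht0 hsupp hSρ hSθ hSu hw
          fun s hs => hfar s (Ico_subset_Icc_self hs)
        have hb : ∀ s ∈ Ico 0 t, E₁ s ≤ 9 * (Real.sqrt (KS * CH * 81270900) * κ / 10) :=
          fun s hs => E1m s _ (by positivity) fun x i => hder s hs x i
        have hlim := CompressibleEuler.le_of_forall_lt_of_continuousOn E1c ht ht0 hb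
        nlinarith
    exact ⟨hc0, hc1⟩
  -- the continuity principle
  have key := ap_bootstrap_two E0c E1c (by positivity) (by positivity) init0 init1 himp
  -- conclusion
  intro t ht x
  obtain ⟨k0, k1⟩ := key t ht
  obtain ⟨d1, d2, d3⟩ := E0d t ht x
  refine ⟨by linarith, by linarith, by linarith, fun i => ?_, fun hx => ?_⟩
  · obtain ⟨f1, f2, f3⟩ := E1d t ht x i
    exact ⟨by linarith, by linarith, by linarith⟩
  · have hw0 : ∀ s ∈ Icc 0 t, ∀ x, |ρ s x - ρbar| ≤ 12 * (κ * r) ∧ |θ s x - θbar| ≤ 12 * (κ * r) ∧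
        ‖u s x - ubar‖ ≤ 12 * (κ * r) := by
      intro s hs y
      have hs' : s ∈ Ico 0 T₀ := ⟨hs.1, hs.2.trans_lt ht.2⟩
      obtain ⟨k0', -⟩ := key s hs'
      obtain ⟨e1, e2, e3⟩ := E0d s hs' y
      exact ⟨by linarith, by linarith, by linarith⟩
    refine ap_support hDm hM hσ h1 h2 h3 h4 h5 hP hPD hsol hsupp ht hδ hw0 x ?_
    have hcDt : cD * t < r / 4 := (mul_lt_mul_of_pos_left ht.2 hcD).trans_le hT₁
    linarith

/-! ## The assembly -/

/-- **The bubble at scale `r` (`BubbleAtScale`) from the five analytic inputs.** Constants (functions of `M` and of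
the constants of the inputs only): `η₁ = (4/5) η₀`, `η₀ = min(η_D/2, η_T, η_H, η_Z, η_E)`, `B = C = √(K_S C_H 81270900) + 9`,
`ε₀ = min(1/(48M), 1/(20B))`, `s₀ = min(1/(4c_D), 1/(2C_T B), 1)` (levels: `c_D` at `M + 1`, `C_T` at `4M`, `C_H` at
`M`; `1 ≤ M` follows from `M⁻¹ ≤ ρ̄ ≤ M`). For `κ = 0` the data are the constant state and the constant solution does
it; for `κ > 0` the a-priori estimate `apriori_bounds` holds for every classical solution with the data on every
`[0, T)`, `T ≤ r s₀`, which is exactly the hypothesis of the existence input (E) (with `Mb = 4M + Bκ`), and applied to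
the solution (E) returns it gives the `C⁰`/`C¹`/support conclusions. -/
theorem bubbleAtScale_of : ZoomHyp → ReadoutHyp → EnergyHyp → SupportHyp → ExistenceHyp → BubbleAtScale := by
  intro hZ hT hH hD hE
  obtain ⟨ηZ, hηZ, hZ'⟩ := hZ
  obtain ⟨⟨ηT, hηT, hT'⟩, ⟨KS, hKS, hS₁, hS₂⟩⟩ := hT
  obtain ⟨ηH, hηH, hH'⟩ := hH
  obtain ⟨ηD, hηD, hD'⟩ := hD
  obtain ⟨ηE, hηE, hE'⟩ := hE
  -- the packing threshold
  obtain ⟨η₀, hη₀⟩ : ∃ η₀ : ℝ, η₀ = min (ηD / 2) (min ηT (min ηH (min ηZ ηE))) := ⟨_, rfl⟩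
  have hη₀pos : 0 < η₀ := by rw [hη₀]; exact lt_min (half_pos hηD) (lt_min hηT (lt_min hηH (lt_min hηZ hηE)))
  have hη₀D : η₀ ≤ ηD / 2 := by rw [hη₀]; exact min_le_left _ _
  have hη₀T : η₀ ≤ ηT := by rw [hη₀]; exact (min_le_right _ _).trans (min_le_left _ _)
  have hη₀H : η₀ ≤ ηH := by rw [hη₀]; exact ((min_le_right _ _).trans (min_le_right _ _)).trans (min_le_left _ _)
  have hη₀Z : η₀ ≤ ηZ := by
    rw [hη₀]; exact (((min_le_right _ _).trans (min_le_right _ _)).trans (min_le_right _ _)).trans (min_le_left _ _)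
  have hη₀E : η₀ ≤ ηE := by
    rw [hη₀]; exact (((min_le_right _ _).trans (min_le_right _ _)).trans (min_le_right _ _)).trans (min_le_right _ _)
  refine ⟨4 / 5 * η₀, by positivity, fun M hM => ?_⟩
  -- the level constants (at `M₁ = max M 1`; `M₁ = M` once a guarded constant state is given)
  obtain ⟨M₁, hM₁⟩ : ∃ M₁ : ℝ, M₁ = max M 1 := ⟨_, rfl⟩
  have hM₁1 : 1 ≤ M₁ := by rw [hM₁]; exact le_max_right _ _
  have hM₁0 : 0 < M₁ := by linarith
  obtain ⟨cD, hcD, hDm⟩ := hD' (M₁ + 1) (by linarith)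
  obtain ⟨CT, hCT, hTm⟩ := hT' (4 * M₁) (by linarith)
  obtain ⟨CH, hCH, hHm⟩ := hH' M₁ hM₁1
  -- the output constants
  obtain ⟨B, hB⟩ : ∃ B : ℝ, B = Real.sqrt (KS * CH * 81270900) + 9 := ⟨_, rfl⟩
  have hC₂0 : 0 ≤ Real.sqrt (KS * CH * 81270900) := Real.sqrt_nonneg _
  have hB9 : 9 ≤ B := by rw [hB]; linarith
  have hB0 : 0 < B := by linarith
  obtain ⟨s₀, hs₀⟩ : ∃ s₀ : ℝ, s₀ = min (1 / (4 * cD)) (min (1 / (2 * CT * B)) 1) := ⟨_, rfl⟩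
  obtain ⟨ε₀, hε₀⟩ : ∃ ε₀ : ℝ, ε₀ = min (1 / (48 * M₁)) (1 / (20 * B)) := ⟨_, rfl⟩
  have hs₀pos : 0 < s₀ := by rw [hs₀]; exact lt_min (by positivity) (lt_min (by positivity) one_pos)
  have hε₀pos : 0 < ε₀ := by rw [hε₀]; exact lt_min (by positivity) (by positivity)
  have hs₀1 : s₀ ≤ 1 / (4 * cD) := by rw [hs₀]; exact min_le_left _ _
  have hs₀2 : s₀ ≤ 1 / (2 * CT * B) := by rw [hs₀]; exact (min_le_right _ _).trans (min_le_left _ _)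
  have hs₀3 : s₀ ≤ 1 := by rw [hs₀]; exact (min_le_right _ _).trans (min_le_right _ _)
  have hε₀1 : ε₀ ≤ 1 / (48 * M₁) := by rw [hε₀]; exact min_le_left _ _
  have hε₀2 : ε₀ ≤ 1 / (20 * B) := by rw [hε₀]; exact min_le_right _ _
  refine ⟨s₀, hs₀pos, ε₀, hε₀pos, B, hB0, fun σ hσ ρbar θbar ubar h1 h2 hη h3 h4 h5 r κ hr hr16 hκ hκr x₀ ρ₀ θ₀ u₀
    hρ₀s hθ₀s hu₀s hsupp hSρ hSθ hSu => ?_⟩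
  -- `1 ≤ M`, so `M₁ = M`
  have hM1 : 1 ≤ M := by
    by_contra hlt
    push Not at hlt
    have h' : 1 < M⁻¹ := (one_lt_inv₀ hM).2 hlt
    linarith [h1.trans h2]
  have hM₁M : M = M₁ := by rw [hM₁]; exact (max_eq_left hM1).symm
  subst hM₁M
  have hρbar : 0 < ρbar := (inv_pos.2 hM).trans_le h1
  have hθbar : 0 < θbar := (inv_pos.2 hM).trans_le h3
  rcases hκ.eq_or_lt with hκ0 | hκpos
  · -- `κ = 0`: the data are the constant state, and the constant solution does it (part A)
    subst hκ0
    exact ap_bubble_const hρbar hθbar hSρ hSθ hSu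
  · -- `κ > 0`
    have hσ3 : 0 < σ ^ 3 := pow_pos hσ 3
    -- packing bookkeeping
    have hP : (ρbar + 1 / (4 * M)) * σ ^ 3 ≤ 5 / 4 * (4 / 5 * η₀) := ap_packing_base h1 hσ hη
    have hPD : 5 / 4 * (4 / 5 * η₀) < ηD := by linarith
    have hPT : 5 / 4 * (4 / 5 * η₀) ≤ ηT := by linarith
    have hPZ : 5 / 4 * (4 / 5 * η₀) ≤ ηZ := by linarith
    have hPE : 5 / 4 * (4 / 5 * η₀) ≤ ηE := by linarith
    have hHη : ρbar * σ ^ 3 ≤ ηH := by linarith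
    -- smallness bookkeeping
    have hκr0 : 0 < κ * r := mul_pos hκpos hr
    have hε₁ : 48 * M * (κ * r) ≤ 1 := by
      have h := (le_div_iff₀ (by positivity : (0 : ℝ) < 48 * M)).1 (hκr.trans hε₀1)
      linarith
    have hε₂ : 20 * B * (κ * r) ≤ 1 := by
      have h := (le_div_iff₀ (by positivity : (0 : ℝ) < 20 * B)).1 (hκr.trans hε₀2)
      linarith
    have hcs : cD * s₀ ≤ 1 / 4 := by
      have h := (le_div_iff₀ (by positivity : (0 : ℝ) < 4 * cD)).1 hs₀1
      linarith
    have hCs : 2 * CT * B * s₀ ≤ 1 := by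
      have h := (le_div_iff₀ (by positivity : (0 : ℝ) < 2 * CT * B)).1 hs₀2
      linarith
    have hT₁ : cD * (r * s₀) ≤ r / 4 := by
      calc cD * (r * s₀) = r * (cD * s₀) := by ring
        _ ≤ r * (1 / 4) := by gcongr
        _ = r / 4 := by ring
    have hT₂ : 2 * CT * B * (r * s₀) ≤ r := by
      calc 2 * CT * B * (r * s₀) = r * (2 * CT * B * s₀) := by ring
        _ ≤ r * 1 := by gcongr
        _ = r := by ring
    have hT₃ : r * s₀ ≤ 10 * r := by
      calc r * s₀ ≤ r * 1 := by gcongr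
        _ ≤ 10 * r := by linarith
    have hrs₀ : 0 < r * s₀ := mul_pos hr hs₀pos
    -- the a-priori estimate for every classical solution with these data on `[0, T)`, `T ≤ r s₀`
    have hAP : ∀ T : ℝ, T ≤ r * s₀ → ∀ (ρ θ : ℝ → T3 → ℝ) (u : ℝ → T3 → V3),
        IsHardSphereEulerSolution σ T ρ u θ → ρ 0 = ρ₀ → u 0 = u₀ → θ 0 = θ₀ →
        ∀ t ∈ Ico 0 T, ∀ x, |ρ t x - ρbar| ≤ 6 * κ * r ∧ |θ t x - θbar| ≤ 6 * κ * r ∧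
          ‖u t x - ubar‖ ≤ 6 * κ * r ∧
          (∀ i : Fin 3, |Torus.partialDeriv i (ρ t) x| ≤ B * κ ∧ ‖Torus.partialDeriv i (u t) x‖ ≤ B * κ ∧
            |Torus.partialDeriv i (θ t) x| ≤ B * κ) ∧
          (4 * r ≤ Torus.euclidDist x x₀ → ρ t x = ρbar ∧ θ t x = θbar ∧ u t x = ubar) := by
      intro T hT ρ θ u hsol hρ0 hu0 hθ0
      have hT₁' : cD * T ≤ r / 4 := (mul_le_mul_of_nonneg_left hT hcD.le).trans hT₁
      have hT₂' : 2 * CT * B * T ≤ r := (mul_le_mul_of_nonneg_left hT (by positivity)).trans hT₂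
      have hT₃' : T ≤ 10 * r := hT.trans hT₃
      refine apriori_bounds hDm hTm hS₁ hS₂ hHm hZ' hcD hCT hKS.le (by linarith) hM1 hσ h1 h2 h3 h4 h5 hP hPD
        hPT hPZ hHη hr hr16 hκpos (by rw [hB]) hε₁ hε₂ hT₁' hT₂' hT₃' hsol ?_ ?_ ?_ ?_
      · rw [hρ0, hθ0, hu0]; exact hsupp
      · rw [hρ0]; exact hSρ
      · rw [hθ0]; exact hSθ
      · rw [hu0]; exact hSu
    -- existence on `[0, r s₀)` (input (E))
    obtain ⟨Mb, hMb⟩ : ∃ Mb : ℝ, Mb = 4 * M + B * κ := ⟨_, rfl⟩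
    have hMb4 : 4 * M ≤ Mb := by
      rw [hMb]
      have := mul_nonneg hB0.le hκ
      linarith
    have hMbpos : 0 < Mb := by linarith
    have hMbinv : Mb⁻¹ ≤ (4 * M)⁻¹ := inv_anti₀ (by positivity) hMb4
    have hδ6 : 6 * κ * r ≤ 1 / (4 * M) := by
      rw [le_div_iff₀ (by positivity)]
      have e : 6 * κ * r * (4 * M) = 48 * M * (κ * r) / 2 := by ring
      rw [e]
      linarith
    have hpos₀ : ∀ x, 0 < ρ₀ x ∧ 0 < θ₀ x ∧ ρ₀ x * σ ^ 3 ≤ ηE := by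
      intro x
      have a1 := (hSρ x).1
      have a2 := (hSθ x).1
      rw [abs_le] at a1 a2
      have hkr : κ * r ≤ 1 / (48 * M) := hκr.trans hε₀1
      have e2 : 1 / (48 * M) = M⁻¹ / 48 := by rw [one_div, mul_inv]; ring
      have e4 : 1 / (4 * M) = M⁻¹ / 4 := by rw [one_div, mul_inv]; ring
      have hp0 : 0 < M⁻¹ := inv_pos.2 hM
      rw [e2] at hkr
      refine ⟨by linarith, by linarith, ?_⟩
      have hle : ρ₀ x ≤ ρbar + 1 / (4 * M) := by rw [e4]; linarith
      exact ((mul_le_mul_of_nonneg_right hle hσ3.le).trans hP).trans hPE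
    obtain ⟨ρ, θ, u, hsol, hρ0, hu0, hθ0⟩ := hE' σ hσ (r * s₀) Mb hrs₀ hMbpos ρ₀ θ₀ u₀ hρ₀s hθ₀s hu₀s
      (fun x => (hpos₀ x).1) (fun x => (hpos₀ x).2.1) (fun x => (hpos₀ x).2.2)
      (fun T hT ρ θ u hsol hρ0 hu0 hθ0 t ht x => by
        obtain ⟨a1, a2, a3, a4, -⟩ := hAP T hT ρ θ u hsol hρ0 hu0 hθ0 t ht x
        obtain ⟨b1, b2, b3, b4, b5, -, -, b8, -, -⟩ := ap_state hM1 h1 h2 h3 h4 h5 hδ6 a1 a2 a3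
        refine ⟨hMbinv.trans b1, b2.trans hMb4, hMbinv.trans b3, b4.trans hMb4, b5.trans hMb4,
          ((mul_le_mul_of_nonneg_right b8 hσ3.le).trans hP).trans hPE, fun i => ?_⟩
        obtain ⟨c1, c2, c3⟩ := a4 i
        have hBM : B * κ ≤ Mb := by rw [hMb]; linarith
        exact ⟨c2.trans hBM, c1.trans hBM, c3.trans hBM⟩)
    -- conclusion
    have hB6 : (6 : ℝ) ≤ B := by linarith
    have h6B : 6 * κ * r ≤ B * κ * r := by
      have := mul_le_mul_of_nonneg_right hB6 hκr0.le
      linarith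
    refine ⟨ρ, θ, u, hsol, hρ0, hθ0, hu0, fun s hs x => ?_, fun s hs x hx => ?_⟩
    · obtain ⟨a1, a2, a3, a4, -⟩ := hAP (r * s₀) le_rfl ρ θ u hsol hρ0 hu0 hθ0 s hs x
      exact ⟨a1.trans h6B, a2.trans h6B, a3.trans h6B, a4⟩
    · exact (hAP (r * s₀) le_rfl ρ θ u hsol hρ0 hu0 hθ0 s hs x).2.2.2.2 hx

end Summit.AtomisticToContinuum.HydrodynamicLimit.Theorems.ConeLocalisation.Bubble

end
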